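import Summits.SmoothPoincare4.SmoothPoincare4.Theses.ConvexBisection
import Summits.SmoothPoincare4.SmoothPoincare4.Theorems.ContractibleTwistedDoubleStandard.Negative.DoubleBisection
import Summits.SmoothPoincare4.SmoothPoincare4.Theorems.ConvexBisectionPlanarBisectionRigidityStubPlanarSeamTransfer
import Literature.Topology.FourManifolds.Gluing
import HarnessLib

/-!
# Line `coloured-string-links-square-free-ac` for crux `ConvexBisection.PlanarBisectionRigidity`
(item stmt-SmoothPoincare4-10511, route `route-SmoothPoincare4-ConvexBisection`, rank 5)

Skeleton (crux-plan, planner-cruxplan-stmt-SmoothPoincare4-10511-coloured-string-link-0, 2026-08-16) of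
the crux idea `Cruxes/PlanarBisectionRigidity/Ideas/coloured-string-links-square-free-ac.md`
("factorisations that differ by a knotted coloured string link bound a 5-manifold over Σ"), reshaped by
the three triage notes (TRIAGE-r1-1/2/3, all `pass` on the lever, all `fail` on the typed endgame
`SquareFreeConjugateAC`, which is the full stable Andrews–Curtis conjecture in costume — DROPPED here).

THE CRUX. For every Hausdorff second-countable `C^∞` 4-manifold `M ≃ₕ S⁴`: if `M = e₁(W₁) ∪ e₂(W₂)` for
two smoothly embedded compact Stein domains meeting exactly along the images of their boundaries, with the
complex tangencies pushed forward to the same plane field on the seam, and the contact boundary of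
`(W₁, J₁)` is PLANAR (`PlanarContactBoundary J₁`), then `M ≅ S⁴`.

THE LINE (four stubs; composition `PlanarBisectionRigidity_of`, kernel-checked, no `sorry` of its own).
Sector split on which half is contractible (planar ⇒ both halves ℚ-acyclic, Etnyre + Mayer–Vietoris, and
`|H₁(W₁;ℤ)| = |H₁(W₂;ℤ)|`; the lever's conclusion "`M` is an honest DOUBLE" is possible only over a
simply connected half):
* `stub_planarSeamTransfer` — SUPPORT (size M): planarity is a property of the contact SEAM, so it passes
  from `(∂W₁, ξ₁)` to `(∂W₂, ξ₂)` across the seam contactomorphism `e₂⁻¹ ∘ e₁`; needed to use the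
  `W₁ ↔ W₂` symmetry of the hypothesis (the crux states planarity on the `J₁` side only).
* `stub_contractibleHalfDouble` — THE LEVER (new; size XL): if moreover `W₁` is CONTRACTIBLE then `M` is a
  double of `W₁` (`IsDouble (∂W₁) (𝓡 4) M`: two copies of `W₁` embedded in `M`, covering it, meeting
  exactly and identically along `∂W₁`).  Paper route = Wendl normal form `M ≅ X_A ∪_{(P_k,φ)} X̄_B`
  (two positive factorisations `A` (for `W₂`) and `B` (for `W₁`) of ONE planar monodromy, both of the
  minimal length `k − 1` because `M` is a homology sphere) + (C1′) the central obstruction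
  `κ(A,B) = A·B⁻¹ ∈ K_k = ker(Adj 𝒟_k → Mod(P_k,∂))` vanishes for such pairs + (C2) a TAME Dehn-quandle
  coloured string link `T` from `B` to `A` exists, so the `P_k`-Lefschetz fibration `V_T → B³` with
  critical locus `T` has `∂V_T = M` and its 2/3-handle pairs (births/deaths of `(t_c, t_c⁻¹)` along the
  arcs) cancel: `V_T ≅ X_B × I`, `M ≅ ∂(X_B × I) = D(X_B) = D(W₁)` — WITHOUT `A ~ B` (Gabai's light
  bulb theorem as the backstop for algebraically-once pairs).
* `stub_planarSteinDoubleStandard` — SHARED ENDGAME (size XL, Andrews–Curtis-complete up to framings by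
  TRIAGE-r1-3 (F1)): the double of a compact contractible Stein domain with planar contact boundary is
  `S⁴` (= the `ψ = id`, `W₁ = W₂` planar slice of the route's rank-4 crux
  `ContractibleTwistedDoubleStandard`; equivalently `W × I ≅ B⁵`).  No shortcut is claimed.
* `stub_nonSimplyConnectedHalves` — RESIDUAL SECTOR (size L/XL): neither half contractible (torsion
  sector `H₁(Wᵢ;ℤ) ≠ 0` — INHABITED: `S⁴ = X_L ∪_ψ X̄_L` along `S³/Q₈`, and the 19 census spheres of
  TRIAGE-r1-2 (S1) — plus the perfect-`π₁` sector).  Not this line's lever (here `M ≇ D(Wᵢ)`: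
  `π₁ D(Wᵢ) = π₁ Wᵢ ≠ 1`); the one-cap / Price–Kim–Miller lever of the sibling lines, filed once.
* `PlanarBisectionRigidity_of : ConvexBisection.PlanarBisectionRigidity` — case on `ContractibleSpace W₁`
  (lever + endgame), else on `ContractibleSpace W₂` (transfer, swap the halves, lever + endgame), else
  the residual stub.

DISPROOF USED. payload.disproof_path (`run/gate/evidence/stmt-SmoothPoincare4-10511/20260816T000009Z-
Disproof.lean`, cdisprove v5) is NOT mounted in this planner jail and `ledger crux cat … Disproof.lean`
reports no workfile (same for all three triagers); its CONTENT is cited from the item's evidence notes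
v1–v5: `of_smoothPoincare4` (crux ⇐ SPC4: every stub below is SPC4-implied — stub 1 is true outright, and
for stub 2 note that `D(W₁)` is itself a homotopy sphere, so under SPC4 both `M` and `D(W₁)` are `S⁴` — hence
refutable AS STATEMENTS only by an exotic `S⁴`; the ENGINE of stub 2, `κ = 1` + tame link, is falsifiable by
computation, see the line card);
`WithoutHomotopyEquiv` false on paper (`S¹×S³ = D(S¹×D³)`, annulus book) — H = `M ≃ₕ S⁴` is USED at
`stub_contractibleHalfDouble` (it forces `n(A) = n(B) = k − 1`: `Adj 𝒟_k → ℤ` is the length, so `κ` is not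
even defined for pairs of unequal length, and `W₂` could otherwise have `b₂ > 0` making "double of `W₁`"
false by homology) and at `stub_nonSimplyConnectedHalves`; `stub_planarSteinDoubleStandard` has no `M` but
`ContractibleSpace W` excludes `S¹×D³`; `WithoutPlanar ∧ SteinBisectionExists ⇒ SPC4` — planarity is used
essentially (Wendl's theorem; no normal form without it); strengthening `HalvesAreBalls` false (Akbulut-cork
double with KOU planar structure) — no stub says a half is a ball: on `D(C)` the lever's conclusion is
literally true (`D(C)` IS a double of `C`) and stub 3 asks `D(C) ≅ S⁴` (true, Mazur); §7 census (k = 5: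
8 certified Hurwitz-inequivalent contractible pairs, undecided twisted spheres `Σ(F,F′)`; all 112
contractible reps AC-trivial; m = 3: 64 pairs, 128/128 AC-trivial) — these are exactly the first instances
of stub 2, and since their `D(X_{F′})` are KNOWN to be `S⁴`, stub 2 alone decides them.  No
`Theorems/PlanarBisectionRigidity/Negative/` lemma has landed (crux dir checked 2026-08-16; negatives index
for SmoothPoincare4: 0), so no stub instantiates a refuted statement.
-/

noncomputable section

open scoped Manifold ContDiff Topology ContinuousMap
open Set Function
open Literature.Geometry.Symplectic Literature.Topology.FourManifolds

-- The namespace is prescribed by the crux protocol (`Summit.<P>.<Sub>.Cruxes.<Crux>.<Slug>` with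
-- `P = Sub = SmoothPoincare4`), hence the duplicated component.
set_option linter.dupNamespace false
set_option linter.unusedVariables false

namespace Summit.SmoothPoincare4.SmoothPoincare4.Cruxes.PlanarBisectionRigidity.ColouredStringLinksSquareFreeAc

open Summit.SmoothPoincare4.SmoothPoincare4.Theses

/-- Local notation: the round 4-sphere with its Mathlib manifold structure. -/
local notation "𝕊⁴" => (Metric.sphere (0 : EuclideanSpace ℝ (Fin 5)) 1)

/-- Local notation: the model space `ℝ⁴`. -/
local notation "E4" => EuclideanSpace ℝ (Fin 4)

/-! ## Stub 1 — support: planarity crosses the seam -/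

/-- **Stub 1 (SUPPORT): planarity of the contact seam passes from `(∂W₁, ξ₁)` to `(∂W₂, ξ₂)`.**  Under
the bisection hypotheses of the crux (two compact Stein domains smoothly embedded in `M`, ranges covering
`M` and meeting exactly in the images of the two boundaries, pushed-forward complex tangencies equal on
the seam), `PlanarContactBoundary J₁ → PlanarContactBoundary J₂`.
Why true (paper, 5 lines): the seam map `ψ = e₂⁻¹ ∘ e₁ : ∂W₁ → ∂W₂` is a diffeomorphism (both `e₁|∂W₁`
and `e₂|∂W₂` are smooth embeddings onto the same smooth hypersurface `e₁(∂W₁) = e₂(∂W₂)` of `M`); given a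
boundary datum `b₁` of `W₁` with a planar open book `ob` supporting `boundaryPlaneField J₁.J b₁`, the datum
`b₂ := ⟨b₁.carrier, ψ ∘ b₁.incl, …⟩` of `W₂` has the SAME carrier, and
`boundaryPlaneField J₂.J b₂ = boundaryPlaneField J₁.J b₁` pointwise by the seam condition, the chain rule
`De₁ ∘ D(incl) = De₂ ∘ D(ψ ∘ incl)` and injectivity of `Deᵢ` (immersions) — so the same `ob` and the same
Giroux form support it.  Orientation is intrinsic (`α ∧ dα`), cf. rattack note (3).  Size M (the missing
piece is Mathlib API: smoothness of `e₂⁻¹ ∘ (e₁ ∘ b₁.incl)` through a codimension-0 embedding with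
boundary, cf. tree `InteriorLift.lean`, `EquidimensionalEmbedding.lean`).  Needed by every line that uses
the `W₁ ↔ W₂` symmetry of the crux hypothesis. -/
theorem stub_planarSeamTransfer
    (M : Type) [TopologicalSpace M] [T2Space M] [SecondCountableTopology M] [ChartedSpace E4 M]
    [IsManifold (𝓡 4) ∞ M]
    (W₁ : Type) [TopologicalSpace W₁] [ChartedSpace (EuclideanHalfSpace 4) W₁] [IsManifold (𝓡∂ 4) ∞ W₁]
    [CompactSpace W₁] (W₂ : Type) [TopologicalSpace W₂] [ChartedSpace (EuclideanHalfSpace 4) W₂]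
    [IsManifold (𝓡∂ 4) ∞ W₂] [CompactSpace W₂] (J₁ : SteinStructure W₁) (J₂ : SteinStructure W₂)
    (e₁ : W₁ → M) (e₂ : W₂ → M)
    (he₁ : Manifold.IsSmoothEmbedding (𝓡∂ 4) (𝓡 4) ∞ e₁)
    (he₂ : Manifold.IsSmoothEmbedding (𝓡∂ 4) (𝓡 4) ∞ e₂)
    (hcover : range e₁ ∪ range e₂ = univ)
    (hseam₁ : range e₁ ∩ range e₂ = e₁ '' (𝓡∂ 4).boundary W₁)
    (hseam₂ : range e₁ ∩ range e₂ = e₂ '' (𝓡∂ 4).boundary W₂)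
    (hξ : ∀ w₁ w₂, e₁ w₁ = e₂ w₂ →
      Submodule.map (mfderiv (𝓡∂ 4) (𝓡 4) e₁ w₁).toLinearMap (contactPlane J₁.J w₁) =
      Submodule.map (mfderiv (𝓡∂ 4) (𝓡 4) e₂ w₂).toLinearMap (contactPlane J₂.J w₂))
    (hpl : PlanarContactBoundary J₁) :
    PlanarContactBoundary J₂ :=
  -- LANDED (wave 1, p76418): `Theorems/ConvexBisectionPlanarBisectionRigidityStubPlanarSeamTransfer.lean`
  Theorems.PlanarBisectionRigidity.ColouredStringLinksSquareFreeAc.stub_planarSeamTransfer M W₁ W₂ J₁ J₂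
    e₁ e₂ he₁ he₂ hcover hseam₁ hseam₂ hξ hpl

/-! ## Stub 2 — the lever: a contractible planar half makes the homotopy sphere an honest double -/

/-- **Stub 2 (THE LEVER, new — coloured-string-link cobordism): a planar common-contact Stein
bisection of a homotopy 4-sphere whose planar half `W₁` is CONTRACTIBLE is a DOUBLE of `W₁`.**  Data:
the crux data verbatim (unbundled) plus `ContractibleSpace W₁`; conclusion
`IsDouble (∂W₁) (𝓡 4) M` for the canonical boundary datum `BoundaryManifold.boundaryData 3 W₁` — `M` is
covered by two smooth embeddings of `W₁` meeting exactly, and identically, along `∂W₁` (so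
`M ≅ D(W₁) = ∂(W₁ × I)` by uniqueness of gluings).  NOT claimed: `W₂ ≅ W₁`, or that the seam map
extends (it need not: Hurwitz-inequivalent planar fillings, Disproof §7).
Why plausibly true — the mechanism of the card, sharpened by triage:
(P-a, known modulo vendoring) Wendl arXiv:0806.3193 Thm 1 + Etnyre math/0404267 Thm 4.1: both halves
are planar Lefschetz fibrations over ONE planar open book `(P_k, φ)` of the seam, `W₂ ≅ X_A`, `W₁ ≅ X_B`
for positive factorisations `A`, `B` of `φ ∈ Mod(P_k, ∂) ≅ PB_{k−1} × ℤ^{k−1}`; `M` a homology sphere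
forces `n(A) = n(B) = k − 1` (ℚ-acyclic halves) and `W₁` contractible makes the seam a `ℤHS³`.
(C1′) OBSTRUCTION: `A = B` in the adjoint group `Adj(𝒟_k)` of the Dehn quandle (signed Hurwitz moves +
insertion/deletion of adjacent `(t_c, t_c⁻¹)`) iff `κ(A,B) := A·B⁻¹ ∈ K_k := ker(Adj 𝒟_k → Mod(P_k,∂))`
vanishes; `K_k` is CENTRAL (triage ✓), its abelian part is the lantern lattice (type counts of the
bipartition classes of the cycles) and is DEAD in this sector — new remark of this plan: with `H₁(X_B) = 0` the
square hole-set matrix `M_B` is unimodular and `M_A M_Aᵀ = N(φ) = M_B M_Bᵀ` (`N(φ)` = the unipotent part of the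
action of `φ` on `H₁(P_k, basepoints)`), so `M_B⁻¹ M_A` is an INTEGER orthogonal matrix, a signed permutation,
and 0/1 entries force a permutation: `A` and `B` have the same type multiset, `κ^{ab}(A,B) = 0` (explaining
the census' 0 discrepancies in 5485 integral buckets, TRIAGE-r1-2, and why the `|det| = 2` torsion pairs
escape); the hidden part is a quotient of `H₂(PB_{k−1} × ℤ^{k−1})` (Hopf, five-term sequence) — the claim is
`κ(A,B) = 1` there whenever `X_B` is contractible and `X_A ∪ X̄_B` is a homotopy sphere (the card's global
(C1) is FALSE in the torsion sector, where this stub does not go: TRIAGE-r1-2 (S1)).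
(C2) CANCELLATION: `A = B` in `Adj` is realised by a `𝒟_k`-coloured string link `T ⊂ D² × I` from `B` to
`A`; the `P_k`-Lefschetz fibration `V_T → B³` branched along `T` is a compact 5-manifold with
`∂V_T = X_A ∪_{(P_k,φ)} X̄_B = M`, sliced by height into `X_B × I ∪` (a 5-dimensional 2-handle along the
vanishing circle at each minimum of `T`: the slice changes by surgery along `c`, triage ✓) `∪` (a 3-handle
on the matching sphere at each maximum); consecutive min/max on one arc meet algebraically once, and
geometrically once iff `T` is TAME (birth and death paths cross only there or over disjoint cycles) ⇒ the
pairs cancel ⇒ `V_T ≅ X_B × I` rel `X_B × 0` ⇒ `M ≅ D(X_B)`; for non-tame `T` with algebraic intersection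
one, Gabai's 4D light-bulb theorem (arXiv:1705.09989; common dual, no 2-torsion in
`π₁ = π₁(X_B)/⟨born circles⟩ = 1`) is the isotopy tool.
Uses H = `M ≃ₕ S⁴` (equal lengths; else `b₂(W₂) > 0` kills the conclusion by homology).  First
instances: the 8 (k = 5) + 64 (k = 4 holes) certified Hurwitz-INEQUIVALENT contractible census pairs of
Disproof §7, whose doubles are known to be `S⁴` — this stub alone decides those spheres.  Size XL (new
mathematics: `K_k`, tameness; plus vendoring Wendl/Etnyre and a Lefschetz-fibration-over-`B³` model).
Cheapest falsifier OF THE ENGINE (not of the stub, which is SPC4-implied): compute the hidden part of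
`K₅` (transgression of `H₂(PB₄ × ℤ⁴)`) and `κ` on the 8 census pairs; search tame links of bounded
complexity between them. -/
theorem stub_contractibleHalfDouble
    (M : Type) [TopologicalSpace M] [T2Space M] [SecondCountableTopology M] [ChartedSpace E4 M]
    [IsManifold (𝓡 4) ∞ M] (hM : M ≃ₕ 𝕊⁴)
    (W₁ : Type) [TopologicalSpace W₁] [ChartedSpace (EuclideanHalfSpace 4) W₁] [IsManifold (𝓡∂ 4) ∞ W₁]
    [CompactSpace W₁] [ContractibleSpace W₁]
    (W₂ : Type) [TopologicalSpace W₂] [ChartedSpace (EuclideanHalfSpace 4) W₂]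
    [IsManifold (𝓡∂ 4) ∞ W₂] [CompactSpace W₂] (J₁ : SteinStructure W₁) (J₂ : SteinStructure W₂)
    (e₁ : W₁ → M) (e₂ : W₂ → M)
    (he₁ : Manifold.IsSmoothEmbedding (𝓡∂ 4) (𝓡 4) ∞ e₁)
    (he₂ : Manifold.IsSmoothEmbedding (𝓡∂ 4) (𝓡 4) ∞ e₂)
    (hcover : range e₁ ∪ range e₂ = univ)
    (hseam₁ : range e₁ ∩ range e₂ = e₁ '' (𝓡∂ 4).boundary W₁)
    (hseam₂ : range e₁ ∩ range e₂ = e₂ '' (𝓡∂ 4).boundary W₂)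
    (hξ : ∀ w₁ w₂, e₁ w₁ = e₂ w₂ →
      Submodule.map (mfderiv (𝓡∂ 4) (𝓡 4) e₁ w₁).toLinearMap (contactPlane J₁.J w₁) =
      Submodule.map (mfderiv (𝓡∂ 4) (𝓡 4) e₂ w₂).toLinearMap (contactPlane J₂.J w₂))
    (hpl : PlanarContactBoundary J₁) :
    IsDouble (BoundaryManifold.boundaryData 3 W₁) (𝓡 4) M := by
  sorry

/-! ## Stub 3 — shared endgame: planar contractible Stein doubles are standard -/

/-- **Stub 3 (SHARED ENDGAME, `PlanarSteinDoubleStandard`): the double of a compact contractible Stein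
domain with planar contact boundary is diffeomorphic to `S⁴`** — for every boundary datum `b` of `W` and
every Hausdorff second-countable smooth 4-manifold `X` that is the gluing `W ∪_{id} W` (`IsDouble b (𝓡 4) X`;
`X` is then compact, `IsClosedGluing.compactSpace`, and a homotopy sphere).  Equivalently `W × I ≅ B⁵`.
This is the `ψ = id`, `W₁ = W₂` planar slice of the route's rank-4 crux `ContractibleTwistedDoubleStandard`
(stmt-SmoothPoincare4-3546) and the statement EVERY surviving line on this crux bottoms out in
(TRIAGE-r1-2/3: seam-walk's doubles, one-cap's (T) at χ = id, this card's (C3)).  Honest status after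
triage: by Wendl `W` is a planar PALF, so `W × I = H⁵(P_B, ε)` is the presentation 5-manifold
(`Literature.Topology.FourManifolds.IsPresentationHandlebodyFive`) of the planar presentation
`P_B = ⟨x₁…x_{k−1} ∣ b₁,…,b_{k−1}⟩` (relators = simple-closed-curve words), and `D(W) ≅ S⁴` follows
whenever `P_B` is stably AC-trivial (Andrews–Curtis 1965 = tree fact
`IsPresentationHandlebodyFive.nonempty_diffeomorph_closedBall_of_isStablyAndrewsCurtisEquivalent`, then
`cerf`/`isDouble_sphere_holds`); every contractible planar filling in the censuses (112 + 128 reps) IS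
AC-trivial by Tietze elimination (Disproof §7), Mazur-type `W` (Oba arXiv:1405.3751, the Akbulut cork with
KOU's planar structure arXiv:1607.07661 Prop 2.3) give `S⁴` outright; but PLANAR-AC in general is the full
stable Andrews–Curtis conjecture (TRIAGE-r1-3 (F1): planar avatars of every balanced presentation; the
card's "square-free island" is void, TRIAGE-r1-1 App. B / r1-2 (S2)) — so NO shortcut is claimed here;
`StrictPropertyTwoRBarrier` bites and is not evaded.  Size XL / open-problem in general; L for the
sub-class actually produced by small `k`.  SPC4-implied. -/
theorem stub_planarSteinDoubleStandard
    (W : Type) [TopologicalSpace W] [T2Space W] [SecondCountableTopology W]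
    [ChartedSpace (EuclideanHalfSpace 4) W] [IsManifold (𝓡∂ 4) ∞ W] [CompactSpace W]
    [ContractibleSpace W] (J : SteinStructure W) (hpl : PlanarContactBoundary J)
    (b : BoundaryData (𝓡∂ 4) W (𝓡 3))
    (X : Type) [TopologicalSpace X] [T2Space X] [SecondCountableTopology X] [ChartedSpace E4 X]
    [IsManifold (𝓡 4) ∞ X] (hX : IsDouble b (𝓡 4) X) :
    Nonempty (X ≃ₘ⟮𝓡 4, 𝓡 4⟯ 𝕊⁴) := by
  sorry

/-! ## Stub 4 — residual sector: neither half simply connected -/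

/-- **Stub 4 (RESIDUAL SECTOR, not this line's lever): a planar common-contact Stein bisection of a
homotopy 4-sphere NEITHER of whose halves is contractible is `S⁴`.**  The crux data verbatim plus
`¬ ContractibleSpace W₁`, `¬ ContractibleSpace W₂`.  Content of the sector: by Etnyre Thm 4.1 +
Mayer–Vietoris both halves are ℚ-acyclic with `|H₁(W₁;ℤ)| = |H₁(W₂;ℤ)|` (`|H₁ ∂W| = |H₁ W|²` for rational
balls), so it is (a) the TORSION sector `H₁(Wᵢ) ≠ 0` — INHABITED: the round `S⁴ = X_L ∪_ψ X̄_L`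
(`X_L = N₋₂(ℝP²)`, seam `S³/Q₈ = M(−1;½,½,½)`, every tight structure on it is planar, TRIAGE-r1-2 (S1)
via GLS arXiv:math/0509714 §4) and the 19 explicit census homotopy spheres `Σ(A,B)` at k = 5 with
`π₁(halves) = ℤ/2` (TRIAGE-r1-2 (S1), words in `planar_torsion_k5_L1_det2.jsonl`); and (b) the
perfect-`π₁` sector (both halves `ℤ`-acyclic with non-trivial perfect fundamental group; no instance
known; planar avatars of balanced presentations of e.g. `SL(2,5)` show such FILLINGS exist for large `k`,
whether in a homotopy-sphere bisection is open).  Here NO double endgame is possible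
(`π₁ D(Wᵢ) = π₁ Wᵢ ≠ 1 = π₁ M`, so `κ ≠ 0` or no tame link — consistent with `κ^{ab} ≠ 0` on the 19
torsion pairs, TRIAGE-r1-2 (a)).  Why plausibly true: spherical seams bounding rational balls on both
sides are confined to the prism family (Choe–Park arXiv:1803.08749 Thm 1.1; lens and lens-sum seams are
excluded by `|H₁ Γ| = |H₁ W|²` + Hantzsche), the symplectic ℚHB fillings of spherical seams are
classified (Etnyre–Ozbagci–Tosun arXiv:2408.09292 Thm 18/20), and for the inhabited seam `S³/Q₈` every
regluing of `ν(ℝP²) ⊂ S⁴` is standard (Price 1977; Kim–Miller arXiv:1805.00429 §3.1) — the missing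
conjunct is "every planar Stein ℚHB filling of `(M(−1;½,½,½), ξ)` is `N₋₂(ℝP²)`" (first test:
`X_A ≟ N₋₂(ℝP²)` for census hit #1, Kirby calculus on explicit words); the one-cap lever
(configuration uniqueness in a rational surface, card `one-cap-two-fillings` (U) ∧ (T″)) is the
general-`k` engine.  Shared residual of ALL four lines on this crux (TRIAGE-r1-2 merge note: "should be
filed once by the lead, not per line").  Size L (torsion, census + recognisers) / open (perfect π₁).
Uses H = `M ≃ₕ S⁴`.  SPC4-implied. -/
theorem stub_nonSimplyConnectedHalves
    (M : Type) [TopologicalSpace M] [T2Space M] [SecondCountableTopology M] [ChartedSpace E4 M]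
    [IsManifold (𝓡 4) ∞ M] (hM : M ≃ₕ 𝕊⁴)
    (W₁ : Type) [TopologicalSpace W₁] [ChartedSpace (EuclideanHalfSpace 4) W₁] [IsManifold (𝓡∂ 4) ∞ W₁]
    [CompactSpace W₁] (W₂ : Type) [TopologicalSpace W₂] [ChartedSpace (EuclideanHalfSpace 4) W₂]
    [IsManifold (𝓡∂ 4) ∞ W₂] [CompactSpace W₂]
    (hW₁ : ¬ ContractibleSpace W₁) (hW₂ : ¬ ContractibleSpace W₂)
    (J₁ : SteinStructure W₁) (J₂ : SteinStructure W₂) (e₁ : W₁ → M) (e₂ : W₂ → M)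
    (he₁ : Manifold.IsSmoothEmbedding (𝓡∂ 4) (𝓡 4) ∞ e₁)
    (he₂ : Manifold.IsSmoothEmbedding (𝓡∂ 4) (𝓡 4) ∞ e₂)
    (hcover : range e₁ ∪ range e₂ = univ)
    (hseam₁ : range e₁ ∩ range e₂ = e₁ '' (𝓡∂ 4).boundary W₁)
    (hseam₂ : range e₁ ∩ range e₂ = e₂ '' (𝓡∂ 4).boundary W₂)
    (hξ : ∀ w₁ w₂, e₁ w₁ = e₂ w₂ →
      Submodule.map (mfderiv (𝓡∂ 4) (𝓡 4) e₁ w₁).toLinearMap (contactPlane J₁.J w₁) =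
      Submodule.map (mfderiv (𝓡∂ 4) (𝓡 4) e₂ w₂).toLinearMap (contactPlane J₂.J w₂))
    (hpl : PlanarContactBoundary J₁) :
    Nonempty (M ≃ₘ⟮𝓡 4, 𝓡 4⟯ 𝕊⁴) := by
  sorry

/-! ## The composition (kernel-checked, no `sorry` of its own) -/

/-- **Swapping the halves.** The bisection hypotheses of the crux are symmetric in `(W₁, J₁, e₁)` and
`(W₂, J₂, e₂)` (pure logic: commutativity of `∪`, `∩` and symmetry of `=`). [folklore] -/
theorem seam_symm
    {M : Type} [TopologicalSpace M] [ChartedSpace E4 M]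
    {W₁ : Type} [TopologicalSpace W₁] [ChartedSpace (EuclideanHalfSpace 4) W₁] [IsManifold (𝓡∂ 4) ∞ W₁]
    [CompactSpace W₁] {W₂ : Type} [TopologicalSpace W₂] [ChartedSpace (EuclideanHalfSpace 4) W₂]
    [IsManifold (𝓡∂ 4) ∞ W₂] [CompactSpace W₂]
    (J₁ : SteinStructure W₁) (J₂ : SteinStructure W₂) {e₁ : W₁ → M} {e₂ : W₂ → M}
    (hcover : range e₁ ∪ range e₂ = univ)
    (hseam₁ : range e₁ ∩ range e₂ = e₁ '' (𝓡∂ 4).boundary W₁)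
    (hseam₂ : range e₁ ∩ range e₂ = e₂ '' (𝓡∂ 4).boundary W₂)
    (hξ : ∀ w₁ w₂, e₁ w₁ = e₂ w₂ →
      Submodule.map (mfderiv (𝓡∂ 4) (𝓡 4) e₁ w₁).toLinearMap (contactPlane J₁.J w₁) =
      Submodule.map (mfderiv (𝓡∂ 4) (𝓡 4) e₂ w₂).toLinearMap (contactPlane J₂.J w₂)) :
    range e₂ ∪ range e₁ = univ ∧
    range e₂ ∩ range e₁ = e₂ '' (𝓡∂ 4).boundary W₂ ∧
    range e₂ ∩ range e₁ = e₁ '' (𝓡∂ 4).boundary W₁ ∧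
    (∀ w₂ w₁, e₂ w₂ = e₁ w₁ →
      Submodule.map (mfderiv (𝓡∂ 4) (𝓡 4) e₂ w₂).toLinearMap (contactPlane J₂.J w₂) =
      Submodule.map (mfderiv (𝓡∂ 4) (𝓡 4) e₁ w₁).toLinearMap (contactPlane J₁.J w₁)) := by
  refine ⟨by rw [union_comm]; exact hcover, by rw [inter_comm]; exact hseam₂,
    by rw [inter_comm]; exact hseam₁, fun w₂ w₁ h => (hξ w₁ w₂ h.symm).symm⟩

/-- **The composition: the four stubs prove the crux `ConvexBisection.PlanarBisectionRigidity` BY NAME.**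
Given the crux data: if `W₁` is contractible, Stub 2 makes `M` a double of `W₁` and Stub 3 (with the
canonical boundary datum of `W₁`; `W₁` is Hausdorff and second countable as a subspace of `M` through the
embedding `e₁`) gives `M ≅ S⁴`; else if `W₂` is contractible, Stub 1 transports planarity to `J₂`, the
halves are swapped (`seam_symm`) and Stubs 2–3 apply to `W₂`; else Stub 4. -/
theorem PlanarBisectionRigidity_of : ConvexBisection.PlanarBisectionRigidity := by
  intro M _ _ _ _ _ hM hb
  obtain ⟨W₁, _, _, _, _, W₂, _, _, _, _, J₁, J₂, e₁, e₂, he₁, he₂, hcover, hseam₁, hseam₂, hξ, hpl⟩ :=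
    hb
  by_cases hW₁ : ContractibleSpace W₁
  · -- home sector, `W₁` contractible: lever + endgame on `W₁`
    haveI : T2Space W₁ := he₁.isEmbedding.t2Space
    haveI : SecondCountableTopology W₁ := he₁.isEmbedding.secondCountableTopology
    have hD := stub_contractibleHalfDouble M hM W₁ W₂ J₁ J₂ e₁ e₂ he₁ he₂ hcover hseam₁ hseam₂ hξ hpl
    exact stub_planarSteinDoubleStandard W₁ J₁ hpl (BoundaryManifold.boundaryData 3 W₁) M hD
  · by_cases hW₂ : ContractibleSpace W₂
    · -- `W₂` contractible: transport planarity across the seam, swap the halves, lever + endgame on `W₂`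
      haveI : T2Space W₂ := he₂.isEmbedding.t2Space
      haveI : SecondCountableTopology W₂ := he₂.isEmbedding.secondCountableTopology
      have hpl₂ : PlanarContactBoundary J₂ :=
        stub_planarSeamTransfer M W₁ W₂ J₁ J₂ e₁ e₂ he₁ he₂ hcover hseam₁ hseam₂ hξ hpl
      obtain ⟨hcover', hseam₂', hseam₁', hξ'⟩ := seam_symm J₁ J₂ hcover hseam₁ hseam₂ hξ
      have hD := stub_contractibleHalfDouble M hM W₂ W₁ J₂ J₁ e₂ e₁ he₂ he₁ hcover' hseam₂' hseam₁'
        hξ' hpl₂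
      exact stub_planarSteinDoubleStandard W₂ J₂ hpl₂ (BoundaryManifold.boundaryData 3 W₂) M hD
    · -- residual sector: neither half contractible
      exact stub_nonSimplyConnectedHalves M hM W₁ W₂ hW₁ hW₂ J₁ J₂ e₁ e₂ he₁ he₂ hcover hseam₁ hseam₂
        hξ hpl

/-! ## Cross-links (sorry-free): where the stubs sit relative to the route's other items -/

/-- **Stub 3 is implied by the route's rank-4 crux `ContractibleTwistedDoubleStandard`** (item
stmt-SmoothPoincare4-3546), even without the planarity hypothesis: a double `W ∪_id W` of a compact Stein
domain is a common-contact Stein bisection (the two embeddings agree on `∂W`, and `ξ ≤ T∂W` is the image of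
`D(incl)`, so the pushed-forward complex tangencies agree — the LANDED negative-side lemma
`Theorems/ContractibleTwistedDoubleStandard/Negative/DoubleBisection.lean`, `double_standard_of_crux`).
So the shared endgame of this line is ALREADY STAFFED as crux 4: the lead should delegate Stub 3 to item
3546 (blocked-on), not attack Andrews–Curtis here. [folklore] -/
theorem planarSteinDoubleStandard_of_crux4 (h4 : ConvexBisection.ContractibleTwistedDoubleStandard)
    (W : Type) [TopologicalSpace W] [T2Space W] [SecondCountableTopology W]
    [ChartedSpace (EuclideanHalfSpace 4) W] [IsManifold (𝓡∂ 4) ∞ W] [CompactSpace W]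
    [ContractibleSpace W] (J : SteinStructure W) (hpl : PlanarContactBoundary J)
    (b : BoundaryData (𝓡∂ 4) W (𝓡 3))
    (X : Type) [TopologicalSpace X] [T2Space X] [SecondCountableTopology X] [ChartedSpace E4 X]
    [IsManifold (𝓡 4) ∞ X] (hX : IsDouble b (𝓡 4) X) :
    Nonempty (X ≃ₘ⟮𝓡 4, 𝓡 4⟯ 𝕊⁴) :=
  Theorems.ContractibleTwistedDoubleStandard.Negative.double_standard_of_crux h4 W J b X hX

/-- **The home sector needs only the lever and crux 4**: given the crux data with `W₁` contractible,
Stub 2 makes `M` a double of `W₁`, hence (by `Negative.DoubleBisection.steinBisection_of_isDouble`) a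
common-contact Stein bisection of `M` by TWO COPIES OF `(W₁, J₁)` — the `W₁ = W₂`, `ψ = id` instance of
`ContractibleTwistedDoubleStandard` — so crux 4 finishes.  This is the precise sense in which the coloured
string link "collapses a twisted planar pair to an honest double without `A` ever being Hurwitz-equivalent
to `B`". [folklore] -/
theorem contractibleSector_of_lever_and_crux4 (h4 : ConvexBisection.ContractibleTwistedDoubleStandard)
    (M : Type) [TopologicalSpace M] [T2Space M] [SecondCountableTopology M] [ChartedSpace E4 M]
    [IsManifold (𝓡 4) ∞ M] (hM : M ≃ₕ 𝕊⁴)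
    (W₁ : Type) [TopologicalSpace W₁] [ChartedSpace (EuclideanHalfSpace 4) W₁] [IsManifold (𝓡∂ 4) ∞ W₁]
    [CompactSpace W₁] [ContractibleSpace W₁]
    (W₂ : Type) [TopologicalSpace W₂] [ChartedSpace (EuclideanHalfSpace 4) W₂]
    [IsManifold (𝓡∂ 4) ∞ W₂] [CompactSpace W₂] (J₁ : SteinStructure W₁) (J₂ : SteinStructure W₂)
    (e₁ : W₁ → M) (e₂ : W₂ → M)
    (he₁ : Manifold.IsSmoothEmbedding (𝓡∂ 4) (𝓡 4) ∞ e₁)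
    (he₂ : Manifold.IsSmoothEmbedding (𝓡∂ 4) (𝓡 4) ∞ e₂)
    (hcover : range e₁ ∪ range e₂ = univ)
    (hseam₁ : range e₁ ∩ range e₂ = e₁ '' (𝓡∂ 4).boundary W₁)
    (hseam₂ : range e₁ ∩ range e₂ = e₂ '' (𝓡∂ 4).boundary W₂)
    (hξ : ∀ w₁ w₂, e₁ w₁ = e₂ w₂ →
      Submodule.map (mfderiv (𝓡∂ 4) (𝓡 4) e₁ w₁).toLinearMap (contactPlane J₁.J w₁) =
      Submodule.map (mfderiv (𝓡∂ 4) (𝓡 4) e₂ w₂).toLinearMap (contactPlane J₂.J w₂))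
    (hpl : PlanarContactBoundary J₁) :
    Nonempty (M ≃ₘ⟮𝓡 4, 𝓡 4⟯ 𝕊⁴) := by
  haveI : T2Space W₁ := he₁.isEmbedding.t2Space
  haveI : SecondCountableTopology W₁ := he₁.isEmbedding.secondCountableTopology
  have hD := stub_contractibleHalfDouble M hM W₁ W₂ J₁ J₂ e₁ e₂ he₁ he₂ hcover hseam₁ hseam₂ hξ hpl
  exact planarSteinDoubleStandard_of_crux4 h4 W₁ J₁ hpl (BoundaryManifold.boundaryData 3 W₁) M hD

end Summit.SmoothPoincare4.SmoothPoincare4.Cruxes.PlanarBisectionRigidity.ColouredStringLinksSquareFreeAc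

end
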